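import Mathlib
import Summits.Ventures.HodgeRepro2.T5AdicCompletionIntegral
import Summits.Ventures.HodgeRepro2.T5AdicCompletionLocalField

/-!
# T5AdicCompletionGaloisInvariance — the valuation of `Lw` is invariant under `Aut(Lw/Kv)`;
norm-one elements are units and the norm-one group is compact (E9 of N4.1, first clause)

Blind cell pub-hodge-repro2, seat p4 (Tier-5 Lean support, annex growth only).
Declaration per README §8(d): uses an L-value-free non-vanishing device: NO.

Row E9 of route/T5-N4.1-route-1.md (the «forcing facts at an inert place», [A] elementary) opens
with «`E¹_v` is compact and equals its own maximal compact subgroup (norm-1 elements are units)».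
On Mathlib's number-field completions `Kv ⊆ Lw` this rests on the GALOIS INVARIANCE of the
valuation: for `σ : Lw ≃ₐ[Kv] Lw`, `w (σ z) = w z`. It is derived here exactly as the
integrality of p395866 — the absolute value `f ∘ σ` of `Lw` extends Mathlib's norm of `Kv` as
well as `f` does (`σ` fixes `Kv`), so both equal the spectral norm
(`spectralNorm_unique_field_norm_ext`, `Kv` complete), hence `f (σ z) = f z` and `w (σ z) = w z`.

* `val_algEquiv_apply` — Galois invariance of `w`;
* `val_eq_one_of_mul_algEquiv_eq_one` — `z · σ z = 1 ⇒ w z = 1` (norm-one elements are units),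
  `mem_adicCompletionIntegers_of_mul_algEquiv_eq_one`;
* `continuous_algEquiv` (`σ` is `Kv`-linear on a finite-dimensional space over the complete `Kv`),
  `isClosed_normOne`, `isCompact_adicCompletionIntegers` (from p396320's `CompactSpace 𝒪[Lw]`),
  **`isCompact_normOne`** — the norm-one group `{z | z · σ z = 1}` is compact.

Nothing here is asserted about the Tier-5 datum.
-/

namespace Summit.Ventures.HodgeRepro2.T5AdicCompletionGaloisInvariance

open IsDedekindDomain HeightOneSpectrum NumberField WithZero WithZeroMulInt
open scoped WithZero NNReal

variable {K : Type*} [Field K] [NumberField K] (v : HeightOneSpectrum (𝓞 K))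
variable {L : Type*} [Field L] [NumberField L] [Algebra K L] (w : HeightOneSpectrum (𝓞 L))
variable [Algebra (v.adicCompletion K) (w.adicCompletion L)]
  [ContinuousSMul (v.adicCompletion K) (w.adicCompletion L)]
  [IsScalarTower K (v.adicCompletion K) (w.adicCompletion L)]

/-- GALOIS INVARIANCE of the valuation of `Lw`: `w (σ z) = w z` for `σ : Lw ≃ₐ[Kv] Lw`. -/
theorem val_algEquiv_apply (σ : w.adicCompletion L ≃ₐ[v.adicCompletion K] w.adicCompletion L)
    (z : w.adicCompletion L) : Valued.v (σ z) = Valued.v z := by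
  obtain ⟨e, he, hxe⟩ := T5AdicCompletionIntegral.exists_val_algebraMap_eq_pow v w
  obtain ⟨b, hb, hbe⟩ := T5AdicCompletionIntegral.exists_base v e he
  set f : AbsoluteValue (w.adicCompletion L) ℝ :=
    T5AdicCompletionIntegral.absOfValuation (Valued.v : Valuation (w.adicCompletion L) ℤᵐ⁰) hb
    with hf_def
  have hf : ∀ x : v.adicCompletion K, f (algebraMap (v.adicCompletion K) (w.adicCompletion L) x) =
      ‖x‖ := fun x => T5AdicCompletionIntegral.absOfValuation_algebraMap v w e he hxe hb hbe x
  let g : AbsoluteValue (w.adicCompletion L) ℝ := f.comp (σ : w.adicCompletion L →+* w.adicCompletion L).injective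
  have hg : ∀ x : v.adicCompletion K, g (algebraMap (v.adicCompletion K) (w.adicCompletion L) x) =
      ‖x‖ := fun x => by
    change f (σ (algebraMap (v.adicCompletion K) (w.adicCompletion L) x)) = ‖x‖
    rw [σ.commutes]; exact hf x
  have h1 := spectralNorm_unique_field_norm_ext hf z
  have h2 := spectralNorm_unique_field_norm_ext hg z
  have h3 : f (σ z) = f z := by
    change g z = f z
    rw [h2, h1]
  rw [hf_def, T5AdicCompletionIntegral.absOfValuation_apply,
    T5AdicCompletionIntegral.absOfValuation_apply] at h3
  exact (toNNReal_strictMono hb).injective (by exact_mod_cast h3)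

/-- Norm-one elements have valuation `1`: `z · σ z = 1 ⇒ w z = 1`. -/
theorem val_eq_one_of_mul_algEquiv_eq_one
    (σ : w.adicCompletion L ≃ₐ[v.adicCompletion K] w.adicCompletion L) {z : w.adicCompletion L}
    (h : z * σ z = 1) : Valued.v z = 1 := by
  have h1 : Valued.v z * Valued.v z = 1 := by
    calc Valued.v z * Valued.v z = Valued.v z * Valued.v (σ z) := by
          rw [val_algEquiv_apply v w σ z]
      _ = Valued.v (z * σ z) := (map_mul _ _ _).symm
      _ = 1 := by rw [h, map_one]
  have hz0 : Valued.v z ≠ 0 := by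
    intro h0; rw [h0, zero_mul] at h1; exact zero_ne_one h1
  rw [← exp_log hz0] at h1 ⊢
  rw [← exp_add] at h1
  have h2 := congrArg log h1
  rw [log_exp, log_one] at h2
  have h3 : log (Valued.v z) = 0 := by omega
  rw [h3, exp_zero]

/-- Norm-one elements lie in `O_Lw` (are units of it). -/
theorem mem_adicCompletionIntegers_of_mul_algEquiv_eq_one
    (σ : w.adicCompletion L ≃ₐ[v.adicCompletion K] w.adicCompletion L) {z : w.adicCompletion L}
    (h : z * σ z = 1) : z ∈ w.adicCompletionIntegers L := by
  rw [mem_adicCompletionIntegers, val_eq_one_of_mul_algEquiv_eq_one v w σ h]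

/-- A `Kv`-automorphism of `Lw` is continuous (`Kv`-linear, `Lw` finite-dimensional over the
complete field `Kv`). -/
theorem continuous_algEquiv
    (σ : w.adicCompletion L ≃ₐ[v.adicCompletion K] w.adicCompletion L) : Continuous σ :=
  LinearMap.continuous_of_finiteDimensional σ.toLinearMap

/-- The norm-one set `{z | z · σ z = 1}` is closed. -/
theorem isClosed_normOne
    (σ : w.adicCompletion L ≃ₐ[v.adicCompletion K] w.adicCompletion L) :
    IsClosed {z : w.adicCompletion L | z * σ z = 1} :=
  isClosed_eq (continuous_id.mul (continuous_algEquiv v w σ)) continuous_const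

omit [Algebra K L] [Algebra (v.adicCompletion K) (w.adicCompletion L)]
  [ContinuousSMul (v.adicCompletion K) (w.adicCompletion L)]
  [IsScalarTower K (v.adicCompletion K) (w.adicCompletion L)] in
/-- `O_Lw` is compact (p396320's `CompactSpace 𝒪[Lw]` read through `𝒪[Lw] = O_Lw`). -/
theorem isCompact_adicCompletionIntegers :
    IsCompact (w.adicCompletionIntegers L : Set (w.adicCompletion L)) := by
  have h := isCompact_iff_compactSpace.mpr (T5AdicCompletionLocalField.compactSpace_integer w)
  have heq : ((Valued.integer (w.adicCompletion L)
      (vK := T5AdicCompletionLocalField.normValued w) : Subring (w.adicCompletion L)) :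
        Set (w.adicCompletion L)) = (w.adicCompletionIntegers L : Set (w.adicCompletion L)) := by
    rw [T5AdicCompletionLocalField.integer_eq]; rfl
  rwa [heq] at h

/-- E9 (first clause) ON THE CONCRETE PAIR: the norm-one group `{z | z · σ z = 1}` is compact —
closed, and contained in the compact `O_Lw`. -/
theorem isCompact_normOne
    (σ : w.adicCompletion L ≃ₐ[v.adicCompletion K] w.adicCompletion L) :
    IsCompact {z : w.adicCompletion L | z * σ z = 1} :=
  (isCompact_adicCompletionIntegers w).of_isClosed_subset (isClosed_normOne v w σ)
    fun _ hz => mem_adicCompletionIntegers_of_mul_algEquiv_eq_one v w σ hz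

end Summit.Ventures.HodgeRepro2.T5AdicCompletionGaloisInvariance
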